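import Literature.MathematicalPhysics.QuantumFieldTheory.Balaban1983to89.B9RWSums346SecondDiffLeft
import Literature.MathematicalPhysics.QuantumFieldTheory.Balaban1983to89.B9Thm310WholeDir

/-!
# `Balaban1983to89.B9RWSums346SecondDiffLeftPairMG` — [B9] Thm 3.10's same-side second-order `L²` members of `G` by the left Neumann series, AT THE LETTERS OF THE
# ALL-BLOCKS AGGREGATOR `B9RWSumsAllBlocksPairMGDir`: the DROP-IN replacements of `B9RWSums346SecondDiffDir.blockBd_second_family5∕3_dir` with the same conclusion shape
# (`|Q|·K·e^{−(1−2α)δd}`, `K = 2N₃B₃`) from that aggregator's own hypotheses MINUS `FactorsL2Second310` (dag-n06-d CALL on LOCATED-SCHEMA-1; the `310` twin of `…GpLeftPairM`)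

T. Bałaban, *Propagators for lattice gauge theories in a background field*, Commun. Math. Phys. **99** (1985) 389–434 [`Balaban1985BackgroundPropagators`, "B9"],
Thm 3.10 (3.105)–(3.108) pp. 414–416, p. 413, (3.46) p. 398, p. 391; T. Bałaban, *Propagators and renormalization transformations for lattice gauge theories. II*,
Commun. Math. Phys. **96** (1984) 223–250 [`Balaban1984PropagatorsII`], (2.52)–(2.55) pp. 232–233, Lemma 2.1 (2.60)–(2.61) p. 234; [`Balaban1985Variational`] (188) p. 308.

statement-level skeleton of published theorems with citation tags; proofs where landed; nothing here is a claim about the Yang–Mills mass gap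

WHY THIS FILE (cell `pub-ymgap`, node N06 [B9], rows 19; width seat `pub-ymgap-dag-n06-w1` (g5)).  The aggregator's letters: `Factors389 … θ₀ δ₁` (both factor majorants at the
legs' rate), `Identities310₂` (fields `invT ∕ eq3105T`), `StaticOK310` (`cntF ≤ N_F`), `1 ≤ M`, ONE (2.61) instance `Ineq261 d₁ … δ₁ α₁`, `Facts347 … δ α L₀` with
`δ ≤ (1−2α₁)δ₁`, `2αδ ≤ δ`, and an «M sufficiently large» threshold:
* §1 ★ `l2line5_left_of_rowSum310` — the series at any rate `δ_V ≥ σ` against the plain row sum at `σ`; conclusion `2N₃B₃·e^{−(δ_V−σ)d}`;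
* §2 ★★ `l2line5_left_pairMG` ∕ ★★ `l2line3_left_pairMG`, ★★★ `blockBd_second_family5_left_pairMG` ∕ ★★★ `blockBd_second_family3_left_pairMG` — the drop-ins: hypotheses = the
  aggregator's at one member and configuration PLUS the factor transposes `hRT` and the threshold `2N_Fθ₀√L₀·c₁(α₁) ≤ M`; conclusion `|Q|·2N₃B₃·e^{−(1−2α)δd}`.
HONEST SCOPE.  Majorant bookkeeping over landed theorems; every analytic input is a displayed hypothesis of the aggregator; nothing of [B9] asserted; COUNT-NEUTRAL; N06 NOT
discharged; K1 NOT closed; one finite lattice programme — nothing continuum, nothing about OS positivity or the mass gap; the YM mass gap (Clay) is NOT proved by any of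
this — R4 closes the conditional finite-𝕋⁴ rung `BalabanLadder.UV` only.  NEW file; 0 `def`.
-/

namespace Literature.MathematicalPhysics.QuantumFieldTheory.Balaban1983to89.B9RWSums346SecondDiffLeftPairMG

open Literature.MathematicalPhysics.QuantumFieldTheory.Balaban1983to89
open Finset B6RandomWalk B6RandomWalkHom B9Thm37Sum B9Thm34Ext B9Thm37Glue B9Thm37Whole B9Cor38Whole B9Thm310Whole B9Thm310WholeDir
open B9RWSums343to347Whole B9RWSums346Schur B9Thm37GlueCor36 B9RWSums343Holder B9RWSums346Lap
open B9RWSums344Input B9RWSums346Two B11SectG B9Thm37AllNorms B9SectDL2Decay B9RWSums346SecondDiff B9RWSums346SecondDiffGpLeft B9RWSums346SecondDiffLeft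

noncomputable section

section GSide

variable {g : B9.Geometry} [Fintype g.Site] [DecidableEq g.Site] {R : ℝ} {H : Prop} {B : B9.Backgrounds}
variable {X Y ι A P : Type} [Fintype P]

omit [Fintype g.Site] [DecidableEq g.Site] [Fintype P] in
/-- Algebra of the transposed (3.106) read through an operator on the right. [folklore] -/
private theorem left_split {Y' : Type} {E : (Y' → ℝ) →ₗ[ℝ] (X → ℝ)} {G G0 V : Module.End ℝ (X → ℝ)} (h : G = G0 + V * G) :
    G ∘ₗ E = G0 ∘ₗ E + V ∘ₗ (G ∘ₗ E) := by
  conv_lhs => rw [h]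
  apply LinearMap.ext
  intro μ
  simp only [LinearMap.comp_apply, LinearMap.add_apply, Module.End.mul_apply]

omit [Fintype g.Site] [DecidableEq g.Site] [Fintype P] in
/-- «M sufficiently large» for the transposed factors: `2N_Fθ₀√L₀·c ≤ M` gives `N_F·θ₀M⁻¹·√L₀·c ≤ ½`. [cite: Balaban1985BackgroundPropagators, p.413 («O(M⁻¹)»), bookkeeping] -/
private theorem small_of_size310 {NF θ₀ L₀ c M : ℝ} (hM : 0 < M) (hbig : 2 * NF * θ₀ * Real.sqrt L₀ * c ≤ M) :
    NF * (θ₀ * M⁻¹) * Real.sqrt L₀ * c ≤ 1 / 2 := by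
  have hMinv : 0 ≤ M⁻¹ := inv_nonneg.mpr hM.le
  have h1 : NF * (θ₀ * M⁻¹) * Real.sqrt L₀ * c = (2 * NF * θ₀ * Real.sqrt L₀ * c) * M⁻¹ / 2 := by ring
  have h2 : (2 * NF * θ₀ * Real.sqrt L₀ * c) * M⁻¹ ≤ 1 := by
    calc (2 * NF * θ₀ * Real.sqrt L₀ * c) * M⁻¹ ≤ M * M⁻¹ := mul_le_mul_of_nonneg_right hbig hMinv
      _ = 1 := mul_inv_cancel₀ hM.ne'
  rw [h1]; linarith

/-! ## §1 The series at a rate `δ_V ≥ σ` against a plain row sum at the rate `σ` -/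

omit [Fintype P] in
/-- ★ **THE SIXTH `L²` MEMBER OF (3.46) FOR THEOREM 3.10's `G` BY THE LEFT NEUMANN SERIES, ROW-SUM FORM**: legs `h_□G_□h_□∇\*∇\*` (`B₃`, rate `δ_L ≥ δ_V`), `Σ_a R♯_a`'s block
bound `θ_V·e^{−δ_Vd}`, the row sum `Σ_{y′}e^{−σd} ≤ c` (`σ ≤ δ_V`), `θ_V·c ≤ ½`, the transposed identities `Δ_aG = I`, `G₀Δ_a = I − Σ_a R♯_a`:
`BlockBd blk blk (G ∘ (∇\*_ν ∘ ∇\*_μ)) (2N₃B₃·e^{−(δ_V−σ)d})`. [cite: Balaban1985BackgroundPropagators, Thm 3.10 (3.105)–(3.108) pp.414–416 + (3.46) p.398; Balaban1984PropagatorsII, (2.54) p.233 + Lemma 2.1 (2.61) p.234; Balaban1985Variational, (188) p.308] -/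
theorem l2line5_left_of_rowSum310 [Fintype X] [DecidableEq X] [Fintype ι] [Fintype A]
    (𝔬 : Ops310 g B X Y ι A) (𝔡 : DirOps310 𝔬 P) (R : ℝ) (H : Prop) (δL δV σ c ρ N N' NF Cℓ N3 B3 θV : ℝ) (κ : Sizes310)
    (S3 : ι → Finset g.Site) (U : B.Cfg)
    (hN3 : 0 ≤ N3) (hB3 : 0 ≤ B3) (hθV : 0 ≤ θV) (hσ : 0 ≤ σ) (hσV : σ ≤ δV) (hVL : δV ≤ δL)
    (hs : StaticOK310 𝔬 ρ N N' NF Cℓ κ) (hcnt3 : ∀ a : g.Site, (∑ i, if a ∈ S3 i then (1 : ℝ) else 0) ≤ N3)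
    (hrow : RowSum (toB6 g R H) σ c) (hinvT : 𝔬.Δa U * 𝔬.G U = 1)
    (h105T : (∑ i, mulOp (𝔬.h i) * 𝔬.Gsq U i * mulOp (𝔬.h i)) * 𝔬.Δa U = 1 - ∑ a, 𝔬.Rt U a)
    (hL : L2SecondLegs310 𝔬 𝔡 R H S3 B3 δL U)
    (hV : BlockBd (g := toB6 g R H) 𝔬.blk 𝔬.blk (∑ a, 𝔬.Rt U a) (fun (y y' : g.Site) => θV * Real.exp (-(δV * g.dist y y'))))
    (hsmall : θV * c ≤ 1 / 2) (ν μ : P) :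
    BlockBd (g := toB6 g R H) 𝔬.blk 𝔬.blk (𝔬.G U ∘ₗ (𝔡.Dsd U ν ∘ₗ 𝔡.Dsd U μ))
      (fun (y y' : g.Site) => 2 * (N3 * B3) * Real.exp (-((δV - σ) * g.dist y y'))) := by
  have htri : Triangle254 (toB6 g R H) := fun a b c => hs.tri a b c
  have hdnn : ∀ a b : (toB6 g R H).Site, 0 ≤ (toB6 g R H).dist a b := fun a b => hs.dnn a b
  have hρ0 : 0 ≤ δV - σ := by linarith
  have hfix := left_split (E := 𝔡.Dsd U ν ∘ₗ 𝔡.Dsd U μ) (fixedPoint_of_388T hinvT h105T)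
  have hsumE : (∑ i, mulOp (𝔬.h i) * 𝔬.Gsq U i * mulOp (𝔬.h i)) ∘ₗ (𝔡.Dsd U ν ∘ₗ 𝔡.Dsd U μ) =
      ∑ i, (mulOp (𝔬.h i) * 𝔬.Gsq U i * mulOp (𝔬.h i)) ∘ₗ (𝔡.Dsd U ν ∘ₗ 𝔡.Dsd U μ) := by
    apply LinearMap.ext
    intro f
    simp only [LinearMap.comp_apply, LinearMap.sum_apply]
  have hhead := blockBd_localSum (R := R) (H := H) 𝔬.blk 𝔬.blk
    (fun i => (mulOp (𝔬.h i) * 𝔬.Gsq U i * mulOp (𝔬.h i)) ∘ₗ (𝔡.Dsd U ν ∘ₗ 𝔡.Dsd U μ))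
    (fun i (a : g.Site) => if a ∈ S3 i then (1 : ℝ) else 0) (fun (a b : g.Site) => B3 * Real.exp (-(δL * g.dist a b))) N3
    (fun a b => mul_nonneg hB3 (Real.exp_nonneg _)) (fun i => hL.l5 i ν μ) hcnt3
  rw [← hsumE] at hhead
  have hS : BlockBd (g := toB6 g R H) 𝔬.blk 𝔬.blk ((∑ i, mulOp (𝔬.h i) * 𝔬.Gsq U i * mulOp (𝔬.h i)) ∘ₗ (𝔡.Dsd U ν ∘ₗ 𝔡.Dsd U μ))
      (fun (a b : g.Site) => N3 * B3 * Real.exp (-((δV - σ) * (toB6 g R H).dist a b))) := by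
    refine hhead.mono fun a b => ?_
    have hexp : Real.exp (-(δL * g.dist a b)) ≤ Real.exp (-((δV - σ) * g.dist a b)) :=
      Real.exp_le_exp.mpr (neg_le_neg (mul_le_mul_of_nonneg_right (by linarith) (hs.dnn a b)))
    calc N3 * (B3 * Real.exp (-(δL * g.dist a b))) = N3 * B3 * Real.exp (-(δL * g.dist a b)) := by ring
      _ ≤ N3 * B3 * Real.exp (-((δV - σ) * g.dist a b)) := mul_le_mul_of_nonneg_left hexp (mul_nonneg hN3 hB3)
      _ = N3 * B3 * Real.exp (-((δV - σ) * (toB6 g R H).dist a b)) := by simp only [toB6_dist]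
  have hV' : BlockBd (g := toB6 g R H) 𝔬.blk 𝔬.blk (∑ a, 𝔬.Rt U a) (fun (a b : g.Site) => θV * Real.exp (-(δV * (toB6 g R H).dist a b))) :=
    hV.mono fun a b => by simp only [toB6_dist]; exact le_rfl
  obtain ⟨M₀, hM₀, hap⟩ := exists_blockBd_const (g := g) (R := R) (H := H) 𝔬.blk 𝔬.blk (𝔬.G U ∘ₗ (𝔡.Dsd U ν ∘ₗ 𝔡.Dsd U μ))
  rw [blockBd_iff_hasMaj] at hS hV' hap
  have hq : (l2w (toB6 g R H) 𝔬.blk (fun _ => (1 : ℝ)) (fun _ => zero_le_one)).κ * θV * c < 1 := by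
    rw [l2w_κ, one_mul]; linarith
  have hN := neumann_majorant (b₁ := l2w (toB6 g R H) 𝔬.blk (fun _ => (1 : ℝ)) (fun _ => zero_le_one))
    (b₂ := l2w (toB6 g R H) 𝔬.blk (fun _ => (1 : ℝ)) (fun _ => zero_le_one)) htri hdnn hrow hθV (mul_nonneg hN3 hB3) hM₀ hρ0 (by linarith)
    hV' hS hfix hap hq
  rw [blockBd_iff_hasMaj]
  refine hN.mono fun a b => ?_
  rw [l2w_κ, one_mul]
  have hinv : (1 - θV * c)⁻¹ ≤ 2 := by
    rw [inv_le_comm₀ (by linarith) (by norm_num : (0 : ℝ) < 2)]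
    linarith
  have hK0 : 0 ≤ N3 * B3 := mul_nonneg hN3 hB3
  calc N3 * B3 * (1 - θV * c)⁻¹ * Real.exp (-((δV - σ) * (toB6 g R H).dist a b))
      ≤ N3 * B3 * 2 * Real.exp (-((δV - σ) * (toB6 g R H).dist a b)) :=
        mul_le_mul_of_nonneg_right (mul_le_mul_of_nonneg_left hinv hK0) (Real.exp_nonneg _)
    _ = 2 * (N3 * B3) * Real.exp (-((δV - σ) * g.dist a b)) := by simp only [toB6_dist]; ring

/-! ## §2 The drop-ins at the aggregator's letters -/

/-- ★★ **THE SIXTH MEMBER PER DIRECTION PAIR AT THE AGGREGATOR'S LETTERS (Thm 3.10)**: `BlockBd blk blk (G ∘ (∇\*_ν ∘ ∇\*_μ)) (2N₃B₃·e^{−(1−2α)δd})` from the factor majorants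
`Factors389 … θ₀ δ₁`, the factor transposes `R♯_a = R_aᵀ`, `Identities310₂` (`invT ∕ eq3105T`), the legs `L2SecondLegs310 … B₃ δ₁`, `Ineq261 d₁ … δ₁ α₁`, `Facts347 … δ α L₀`
(`0 ≤ αδ`, `2αδ ≤ δ`, `δ ≤ (1−2α₁)δ₁`), `1 ≤ M` and the threshold `2N_Fθ₀√L₀·c₁(α₁) ≤ M` — NO `FactorsL2Second310`, NO sup majorant of `G`.
[cite: Balaban1985BackgroundPropagators, Thm 3.10 (3.105)–(3.108) pp.414–416, p.413, (3.46) p.398, p.391; Balaban1984PropagatorsII, (2.52)–(2.55) pp.232–233, Lemma 2.1 (2.60)–(2.61) p.234] -/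
theorem l2line5_left_pairMG [Fintype X] [DecidableEq X] [Fintype ι] [Fintype A]
    (𝔬 : Ops310 g B X Y ι A) (𝔡 : DirOps310 𝔬 P) (𝔩 : DirLetters310 𝔬 P) (R : ℝ) (H : Prop) (d d₁ : ℕ) (δ α L₀ δ₁ α₁ ρ N N' NF Cℓ N3 B3 θ₀ : ℝ)
    (κ : Sizes310) (S3 : ι → Finset g.Site) (U : B.Cfg)
    (hNF : 0 ≤ NF) (hN3 : 0 ≤ N3) (hB3 : 0 ≤ B3) (hθ₀ : 0 ≤ θ₀) (hδ₁ : 0 ≤ δ₁) (hα₁ : 0 ≤ α₁) (hα : 0 ≤ α * δ) (hα2 : 2 * α * δ ≤ δ)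
    (hδ5 : δ ≤ (1 - 2 * α₁) * δ₁) (hs : StaticOK310 𝔬 ρ N N' NF Cℓ κ) (hM1 : 1 ≤ g.M)
    (hMbig : 2 * NF * θ₀ * Real.sqrt L₀ * B6.c1 d₁ δ₁ α₁ ≤ g.M)
    (hcnt3 : ∀ a : g.Site, (∑ i, if a ∈ S3 i then (1 : ℝ) else 0) ≤ N3)
    (h261 : Ineq261 d₁ (toB6 g R H) δ₁ α₁) (hF : Facts347 g R H d δ α L₀) (hi : Identities310₂ 𝔬 𝔡 𝔩 R H U)
    (hfac : Factors389 𝔬 R H θ₀ δ₁ U) (hRT : ∀ a, IsTransposePair (𝔬.Rt U a) (𝔬.Rf U a)) (hL : L2SecondLegs310 𝔬 𝔡 R H S3 B3 δ₁ U) (ν μ : P) :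
    BlockBd (g := toB6 g R H) 𝔬.blk 𝔬.blk (𝔬.G U ∘ₗ (𝔡.Dsd U ν ∘ₗ 𝔡.Dsd U μ))
      (fun (y y' : g.Site) => 2 * (N3 * B3) * Real.exp (-((1 - 2 * α) * δ * g.dist y y'))) := by
  have hMpos : 0 < g.M := lt_of_lt_of_le one_pos hM1
  have hV0 := blockBd_sumRt_of_factors389 (R := R) (H := H) 𝔬 U hF hα hθ₀ hNF hM1 hs hfac hRT
  have hθV : 0 ≤ NF * (θ₀ * g.M⁻¹) * Real.sqrt L₀ := mul_nonneg (mul_nonneg hNF (mul_nonneg hθ₀ (inv_nonneg.mpr hMpos.le))) (Real.sqrt_nonneg _)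
  have hsmall : NF * (θ₀ * g.M⁻¹) * Real.sqrt L₀ * B6.c1 d₁ δ₁ α₁ ≤ 1 / 2 := small_of_size310 hMpos hMbig
  have hrow : RowSum (toB6 g R H) (α₁ * δ₁) (B6.c1 d₁ δ₁ α₁) := (rowSum_iff_ineq261 d₁ (toB6 g R H) δ₁ α₁).mp h261
  have hσV : α₁ * δ₁ ≤ δ₁ - α * δ := by nlinarith
  have hK : 0 ≤ 2 * (N3 * B3) := by positivity
  have h := l2line5_left_of_rowSum310 𝔬 𝔡 R H δ₁ (δ₁ - α * δ) (α₁ * δ₁) (B6.c1 d₁ δ₁ α₁) ρ N N' NF Cℓ N3 B3 _ κ S3 U hN3 hB3 hθV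
    (mul_nonneg hα₁ hδ₁) hσV (by linarith) hs hcnt3 hrow hi.invT hi.eq3105T hL hV0 hsmall ν μ
  refine h.mono fun a b => mul_le_mul_of_nonneg_left ?_ hK
  exact Real.exp_le_exp.mpr (neg_le_neg (mul_le_mul_of_nonneg_right (by nlinarith) (hs.dnn a b)))

/-- ★★ **THE FOURTH MEMBER PER DIRECTION PAIR (Thm 3.10)** by adjoint transfer (`G` symmetric, Thm 3.11). [cite: Balaban1985BackgroundPropagators, (3.46) p.398 (fourth member) + p.391 + Thm 3.10 pp.414–416 + Thm 3.11 p.416] -/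
theorem l2line3_left_pairMG [Fintype X] [DecidableEq X] [Fintype ι] [Fintype A]
    (𝔬 : Ops310 g B X Y ι A) (𝔡 : DirOps310 𝔬 P) (𝔩 : DirLetters310 𝔬 P) (R : ℝ) (H : Prop) (d d₁ : ℕ) (δ α L₀ δ₁ α₁ ρ N N' NF Cℓ N3 B3 θ₀ : ℝ)
    (κ : Sizes310) (S3 : ι → Finset g.Site) (U : B.Cfg)
    (hNF : 0 ≤ NF) (hN3 : 0 ≤ N3) (hB3 : 0 ≤ B3) (hθ₀ : 0 ≤ θ₀) (hδ₁ : 0 ≤ δ₁) (hα₁ : 0 ≤ α₁) (hα : 0 ≤ α * δ) (hα2 : 2 * α * δ ≤ δ)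
    (hδ5 : δ ≤ (1 - 2 * α₁) * δ₁) (hs : StaticOK310 𝔬 ρ N N' NF Cℓ κ) (hM1 : 1 ≤ g.M)
    (hMbig : 2 * NF * θ₀ * Real.sqrt L₀ * B6.c1 d₁ δ₁ α₁ ≤ g.M)
    (hcnt3 : ∀ a : g.Site, (∑ i, if a ∈ S3 i then (1 : ℝ) else 0) ≤ N3)
    (h261 : Ineq261 d₁ (toB6 g R H) δ₁ α₁) (hF : Facts347 g R H d δ α L₀) (hi : Identities310₂ 𝔬 𝔡 𝔩 R H U)
    (hfac : Factors389 𝔬 R H θ₀ δ₁ U) (hRT : ∀ a, IsTransposePair (𝔬.Rt U a) (𝔬.Rf U a)) (hL : L2SecondLegs310 𝔬 𝔡 R H S3 B3 δ₁ U)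
    (hDT : DirTranspose310 𝔬 𝔡 U) (hsym : IsTransposePair (𝔬.G U) (𝔬.G U)) (ν μ : P) :
    BlockBd (g := toB6 g R H) 𝔬.blk 𝔬.blk ((𝔡.Dd U ν ∘ₗ 𝔡.Dd U μ) ∘ₗ 𝔬.G U)
      (fun (y y' : g.Site) => 2 * (N3 * B3) * Real.exp (-((1 - 2 * α) * δ * g.dist y y'))) := by
  have h5 := l2line5_left_pairMG 𝔬 𝔡 𝔩 R H d d₁ δ α L₀ δ₁ α₁ ρ N N' NF Cℓ N3 B3 θ₀ κ S3 U hNF hN3 hB3 hθ₀ hδ₁ hα₁ hα hα2 hδ5 hs hM1 hMbig hcnt3 h261 hF hi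
    hfac hRT hL μ ν
  have hK : 0 ≤ 2 * (N3 * B3) := by positivity
  have hadj : IsTransposePair (𝔬.G U ∘ₗ (𝔡.Dsd U μ ∘ₗ 𝔡.Dsd U ν)) ((𝔡.Dd U ν ∘ₗ 𝔡.Dd U μ) ∘ₗ 𝔬.G U) :=
    ((hDT.tr ν).comp (hDT.tr μ)).comp hsym
  have h := blockBd_of_adjoint (g := toB6 g R H) (blk₁ := 𝔬.blk) (blk₂ := 𝔬.blk) (T := (𝔡.Dd U ν ∘ₗ 𝔡.Dd U μ) ∘ₗ 𝔬.G U)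
    (T' := 𝔬.G U ∘ₗ (𝔡.Dsd U μ ∘ₗ 𝔡.Dsd U ν)) (fun u w => by
      rw [dotProduct, dotProduct]
      exact (hadj u w).symm) h5 (fun y y' => mul_nonneg hK (Real.exp_nonneg _))
  refine h.mono fun y y' => ?_
  rw [hs.symm y' y]

/-- ★★★ **THE DROP-IN FOR `blockBd_second_family5_dir`** (the family `G∇\*_{U,ν}∇\*_{U,μ}` over `Q × Q`): `|Q|·2N₃B₃·e^{−(1−2α)δd}` — textually `…_dir`'s conclusion with
`secondConst … ↦ 2N₃B₃`, from its hypotheses WITHOUT `FactorsL2Second310` ∕ `h0` (see `l2line5_left_pairMG`). [cite: Balaban1985BackgroundPropagators, (3.46) p.398 + (3.39) p.397 + Thm 3.10 pp.414–416] -/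
theorem blockBd_second_family5_left_pairMG [Fintype X] [DecidableEq X] [Fintype ι] [Fintype A]
    (𝔬 : Ops310 g B X Y ι A) (𝔡 : DirOps310 𝔬 P) (𝔩 : DirLetters310 𝔬 P) (R : ℝ) (H : Prop) (d d₁ : ℕ) (δ α L₀ δ₁ α₁ ρ N N' NF Cℓ N3 B3 θ₀ : ℝ)
    (κ : Sizes310) (S3 : ι → Finset g.Site) (U : B.Cfg)
    (hNF : 0 ≤ NF) (hN3 : 0 ≤ N3) (hB3 : 0 ≤ B3) (hθ₀ : 0 ≤ θ₀) (hδ₁ : 0 ≤ δ₁) (hα₁ : 0 ≤ α₁) (hα : 0 ≤ α * δ) (hα2 : 2 * α * δ ≤ δ)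
    (hδ5 : δ ≤ (1 - 2 * α₁) * δ₁) (hs : StaticOK310 𝔬 ρ N N' NF Cℓ κ) (hM1 : 1 ≤ g.M)
    (hMbig : 2 * NF * θ₀ * Real.sqrt L₀ * B6.c1 d₁ δ₁ α₁ ≤ g.M)
    (hcnt3 : ∀ a : g.Site, (∑ i, if a ∈ S3 i then (1 : ℝ) else 0) ≤ N3)
    (h261 : Ineq261 d₁ (toB6 g R H) δ₁ α₁) (hF : Facts347 g R H d δ α L₀) (hi : Identities310₂ 𝔬 𝔡 𝔩 R H U)
    (hfac : Factors389 𝔬 R H θ₀ δ₁ U) (hRT : ∀ a, IsTransposePair (𝔬.Rt U a) (𝔬.Rf U a)) (hL : L2SecondLegs310 𝔬 𝔡 R H S3 B3 δ₁ U) :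
    BlockBd (g := toB6 g R H) 𝔬.blk (𝔬.blk ∘ Prod.fst)
      (familyOp fun p : P × P => 𝔬.G U ∘ₗ (𝔡.Dsd U p.1 ∘ₗ 𝔡.Dsd U p.2))
      (fun (a b : g.Site) => (Fintype.card P : ℝ) * (2 * (N3 * B3)) * Real.exp (-((1 - 2 * α) * δ * g.dist a b))) := by
  have hK : 0 ≤ 2 * (N3 * B3) := by positivity
  have h := blockBd_familyOp (R := R) (H := H) 𝔬.blk 𝔬.blk (P := P × P)
    (T := fun p : P × P => 𝔬.G U ∘ₗ (𝔡.Dsd U p.1 ∘ₗ 𝔡.Dsd U p.2)) (fun a b => mul_nonneg hK (Real.exp_nonneg _))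
    (fun p => l2line5_left_pairMG 𝔬 𝔡 𝔩 R H d d₁ δ α L₀ δ₁ α₁ ρ N N' NF Cℓ N3 B3 θ₀ κ S3 U hNF hN3 hB3 hθ₀ hδ₁ hα₁ hα hα2 hδ5 hs hM1 hMbig hcnt3 h261 hF hi
      hfac hRT hL p.1 p.2)
  refine h.mono fun a b => le_of_eq ?_
  rw [Fintype.card_prod, Nat.cast_mul, Real.sqrt_mul_self (Nat.cast_nonneg _)]
  ring

/-- ★★★ **THE DROP-IN FOR `blockBd_second_family3_dir`** (`∇_ν∇_μG` over `Q × Q`; `G` symmetric): same hypotheses + `DirTranspose310` + `hsym`, same shape.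
[cite: Balaban1985BackgroundPropagators, (3.46) p.398 (fourth member) + (3.39) p.397 + p.391 + Thm 3.10 pp.414–416] -/
theorem blockBd_second_family3_left_pairMG [Fintype X] [DecidableEq X] [Fintype ι] [Fintype A]
    (𝔬 : Ops310 g B X Y ι A) (𝔡 : DirOps310 𝔬 P) (𝔩 : DirLetters310 𝔬 P) (R : ℝ) (H : Prop) (d d₁ : ℕ) (δ α L₀ δ₁ α₁ ρ N N' NF Cℓ N3 B3 θ₀ : ℝ)
    (κ : Sizes310) (S3 : ι → Finset g.Site) (U : B.Cfg)
    (hNF : 0 ≤ NF) (hN3 : 0 ≤ N3) (hB3 : 0 ≤ B3) (hθ₀ : 0 ≤ θ₀) (hδ₁ : 0 ≤ δ₁) (hα₁ : 0 ≤ α₁) (hα : 0 ≤ α * δ) (hα2 : 2 * α * δ ≤ δ)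
    (hδ5 : δ ≤ (1 - 2 * α₁) * δ₁) (hs : StaticOK310 𝔬 ρ N N' NF Cℓ κ) (hM1 : 1 ≤ g.M)
    (hMbig : 2 * NF * θ₀ * Real.sqrt L₀ * B6.c1 d₁ δ₁ α₁ ≤ g.M)
    (hcnt3 : ∀ a : g.Site, (∑ i, if a ∈ S3 i then (1 : ℝ) else 0) ≤ N3)
    (h261 : Ineq261 d₁ (toB6 g R H) δ₁ α₁) (hF : Facts347 g R H d δ α L₀) (hi : Identities310₂ 𝔬 𝔡 𝔩 R H U)
    (hfac : Factors389 𝔬 R H θ₀ δ₁ U) (hRT : ∀ a, IsTransposePair (𝔬.Rt U a) (𝔬.Rf U a)) (hL : L2SecondLegs310 𝔬 𝔡 R H S3 B3 δ₁ U)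
    (hDT : DirTranspose310 𝔬 𝔡 U) (hsym : IsTransposePair (𝔬.G U) (𝔬.G U)) :
    BlockBd (g := toB6 g R H) 𝔬.blk (𝔬.blk ∘ Prod.fst)
      (familyOp fun p : P × P => (𝔡.Dd U p.1 ∘ₗ 𝔡.Dd U p.2) ∘ₗ 𝔬.G U)
      (fun (a b : g.Site) => (Fintype.card P : ℝ) * (2 * (N3 * B3)) * Real.exp (-((1 - 2 * α) * δ * g.dist a b))) := by
  have hK : 0 ≤ 2 * (N3 * B3) := by positivity
  have h := blockBd_familyOp (R := R) (H := H) 𝔬.blk 𝔬.blk (P := P × P)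
    (T := fun p : P × P => (𝔡.Dd U p.1 ∘ₗ 𝔡.Dd U p.2) ∘ₗ 𝔬.G U) (fun a b => mul_nonneg hK (Real.exp_nonneg _))
    (fun p => l2line3_left_pairMG 𝔬 𝔡 𝔩 R H d d₁ δ α L₀ δ₁ α₁ ρ N N' NF Cℓ N3 B3 θ₀ κ S3 U hNF hN3 hB3 hθ₀ hδ₁ hα₁ hα hα2 hδ5 hs hM1 hMbig hcnt3 h261 hF hi
      hfac hRT hL hDT hsym p.1 p.2)
  refine h.mono fun a b => le_of_eq ?_
  rw [Fintype.card_prod, Nat.cast_mul, Real.sqrt_mul_self (Nat.cast_nonneg _)]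
  ring

end GSide

end

end Literature.MathematicalPhysics.QuantumFieldTheory.Balaban1983to89.B9RWSums346SecondDiffLeftPairMG
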